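import Literature.Barriers.ValiantsHypothesis.MonotoneGapParseTrees
import Literature.LinearAlgebra.Matrix.PermanentSubperm
import Mathlib.Data.Nat.Choose.Sum
import HarnessLib

/-!
# Jerrum–Snir's upper bound for the monotone complexity of the permanent (J. ACM 29 (1982), §4.3)

The upper bound half of §4.3 of

* [JerrumSnir1982] M. Jerrum, M. Snir, *Some exact complexity results for straight-line
  computations over semirings*, J. ACM 29 (1982) 874–897, p. 889:

"This lower bound is in fact attained by the permanental equivalent of Laplace's expansion rule
for determinants. Essentially, we form the permanents of all the `r × r` submatrices contained in
the first `r` rows of `X` (the "subpermanents" of the first `r` rows) recursively from all the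
`(r - 1) × (r - 1)` subpermanents of the first `r - 1` rows. The upper bound of `n(2^{n-1} - 1)`
is then implied by the recurrence `C(r) = C(r - 1) + r·(n choose r)`, `C(1) = 0`."

We build this computation as an explicit monotone computation (`IsMonotoneComputation`,
`MonotoneGap.lean`: a plain fan-in-two `ArithCircuit` over `ℝ≥0`) of
`perPoly (Fin n) ℝ≥0 = per (X_{ij})` and count its product gates:

* `JerrumSnir.emitAcc`, `JerrumSnir.emitSumProd` — appending, to a gate list, the `2k - 1` gates
  computing `Σ_{i ∈ l} X_{x i} · (value of the operand u i)` for a list `l` of length `k` (with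
  sharing: the operands `u i` refer to earlier gates), and their specifications (`OpOK`,
  `emitAcc_spec`, `emitSumProd_spec`);
* `JerrumSnir.subPer T` — the subpermanent of the generic matrix on the columns `T` and the first
  `|T|` rows (`Matrix.subperm` of `Literature/LinearAlgebra/Matrix/PermanentSubperm.lean`), with
  `subPer_singleton`, the Laplace step `subPer_step` (expansion along the last row,
  `Matrix.subperm_expand_row`) and `subPer_univ = perPoly`;
* `JerrumSnir.laplaceCircuit hn` — the circuit processing the column sets level by level
  (`processSubset`, `processLevel`, `buildFrom`, with the invariant `Good` and the specifications
  `processSubset_spec`, `processLevel_spec`, `buildFrom_spec`), and `laplaceCircuit_spec`: it is a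
  monotone computation of `per_n` with exactly `Σ_{r=2}^{n} r·C(n,r) = n(2^{n-1} - 1)` product
  gates (`sum_Ico_choose_mul`); `exists_isMonotoneComputation_perPoly` is the existence statement
  used for the named fact `JerrumSnir1982_permanent` (assembled in `MonotoneGapProofs.lean`).
-/

noncomputable section

namespace Literature.Barriers.ValiantsHypothesis

namespace JerrumSnir

open Literature.Computability.AlgebraicComplexity MvPolynomial Finset
open ArithCircuit (Gate Operand gateValues)
open scoped NNReal

universe u v w

/-! ### Appending gates: operands that keep their value -/

section Emit

variable {k : Type u} [CommSemiring k] {σ : Type v} {ι : Type w}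

/-- `OpOK gs u f`: the operand `u` is valid after the gate list `gs` (it refers to a gate of `gs`,
a variable or a constant) and its value is `f`. [folklore] -/
def OpOK (gs : List (Gate k σ)) (u : Operand k σ) (f : MvPolynomial σ k) : Prop :=
  match u with
  | .var i => X i = f
  | .const c => C c = f
  | .gate j => j < gs.length ∧ gateVal gs j = f

/-- Appending gates does not change the values of the earlier gates. [folklore] -/
theorem gateVal_of_prefix {gs gs' : List (Gate k σ)} (h : gs <+: gs') {j : ℕ} (hj : j < gs.length) :
    gateVal gs' j = gateVal gs j := by
  have hlen : gs.length ≤ gs'.length := h.length_le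
  have htake : gs'.take gs.length = gs := (List.prefix_iff_eq_take.1 h).symm
  have hv : gateValues gs = (gateValues gs').take gs.length := by
    rw [← gateValues_take gs' hlen, htake]
  unfold gateVal
  rw [hv, List.getD_eq_getElem?_getD, List.getD_eq_getElem?_getD, List.getElem?_take, if_pos hj]

/-- A variable operand is always valid, with value the variable. [folklore] -/
theorem OpOK.var (gs : List (Gate k σ)) (i : σ) : OpOK gs (.var i) (X i) := rfl

/-- A valid operand keeps its value when read at any later position of any extension.
[folklore] -/
theorem OpOK.opVal_eq {gs gs' : List (Gate k σ)} {u : Operand k σ} {f : MvPolynomial σ k}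
    (h : OpOK gs u f) (hpre : gs <+: gs') {j : ℕ} (hj : gs.length ≤ j) : opVal gs' j u = f := by
  cases u with
  | var i => exact h
  | const c => exact h
  | gate j' =>
    obtain ⟨hlt, hval⟩ := h
    rw [opVal_gate, if_pos (lt_of_lt_of_le hlt hj), gateVal_of_prefix hpre hlt, hval]

/-- A valid operand stays valid in any extension. [folklore] -/
theorem OpOK.of_prefix {gs gs' : List (Gate k σ)} {u : Operand k σ} {f : MvPolynomial σ k}
    (h : OpOK gs u f) (hpre : gs <+: gs') : OpOK gs' u f := by
  cases u with
  | var i => exact h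
  | const c => exact h
  | gate j' =>
    obtain ⟨hlt, hval⟩ := h
    exact ⟨lt_of_lt_of_le hlt hpre.length_le, by rw [gateVal_of_prefix hpre hlt, hval]⟩

/-- The value of a binary product gate. [folklore] -/
theorem gateVal_prod_two {gs : List (Gate k σ)} {j : ℕ} {u v : Operand k σ}
    (h : gs[j]? = some (.prod [u, v])) : gateVal gs j = opVal gs j u * opVal gs j v := by
  rw [gateVal_prod gs h]
  simp

/-- The value of a plain binary sum gate. [folklore] -/
theorem gateVal_sum_two {gs : List (Gate k σ)} {j : ℕ} {u v : Operand k σ}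
    (h : gs[j]? = some (.sum [(1, u), (1, v)])) : gateVal gs j = opVal gs j u + opVal gs j v := by
  rw [gateVal_sum gs h]
  simp

variable (x : ι → σ) (u : ι → Operand k σ)

/-- Accumulate `Σ_{i ∈ l} X_{x i} · u i` onto the operand `acc`: for every `i`, one product gate
`X_{x i} · u i` and one plain sum gate adding it to the accumulator (the straight-line program
of JS p. 889, one row of Laplace's expansion). [cite: JerrumSnir1982, §4.3 (p. 889)] -/
def emitAcc : List (Gate k σ) → Operand k σ → List ι → List (Gate k σ) × Operand k σ
  | gs, acc, [] => (gs, acc)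
  | gs, acc, i :: rest =>
    emitAcc (gs ++ [Gate.prod [.var (x i), u i], Gate.sum [(1, acc), (1, .gate gs.length)]])
      (.gate (gs.length + 1)) rest

/-- Compute `Σ_{i ∈ l} X_{x i} · u i` with `|l|` product gates and `|l| - 1` plain sum gates
(the empty sum is the constant `0`). [cite: JerrumSnir1982, §4.3 (p. 889)] -/
def emitSumProd : List (Gate k σ) → List ι → List (Gate k σ) × Operand k σ
  | gs, [] => (gs, .const 0)
  | gs, i :: rest => emitAcc x u (gs ++ [Gate.prod [.var (x i), u i]]) (.gate gs.length) rest

/-- Specification of `emitAcc`: it extends the gate list, its operand is valid with value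
`acc + Σ_{i ∈ l} X_{x i} · f i` when `u i` is valid with value `f i`, it adds `|l|` product gates,
and every new gate is a binary product or a plain binary sum. [cite: JerrumSnir1982, §4.3 (p. 889)] -/
theorem emitAcc_spec (f : ι → MvPolynomial σ k) :
    ∀ (l : List ι) (gs : List (Gate k σ)) (acc : Operand k σ) (A : MvPolynomial σ k),
      OpOK gs acc A → (∀ i ∈ l, OpOK gs (u i) (f i)) →
        gs <+: (emitAcc x u gs acc l).1 ∧
        OpOK (emitAcc x u gs acc l).1 (emitAcc x u gs acc l).2
          (A + (l.map fun i => X (x i) * f i).sum) ∧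
        ((emitAcc x u gs acc l).1.countP fun g => isProdGate g) =
          (gs.countP fun g => isProdGate g) + l.length ∧
        (∀ g ∈ (emitAcc x u gs acc l).1, g ∈ gs ∨ (g.fanIn = 2 ∧ IsPlainGate g))
  | [], gs, acc, A, hacc, _ => by
    refine ⟨List.prefix_rfl, ?_, by simp [emitAcc], fun g hg => Or.inl hg⟩
    simpa [emitAcc] using hacc
  | i :: rest, gs, acc, A, hacc, hl => by
    set gs₂ := gs ++ [Gate.prod [.var (x i), u i], Gate.sum [(1, acc), (1, .gate gs.length)]]
      with hgs₂
    have hpre : gs <+: gs₂ := List.prefix_append _ _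
    have hlen : gs₂.length = gs.length + 2 := by simp [hgs₂]
    have hget1 : gs₂[gs.length]? = some (Gate.prod [.var (x i), u i]) := by simp [hgs₂]
    have hget2 : gs₂[gs.length + 1]? = some (Gate.sum [(1, acc), (1, .gate gs.length)]) := by
      simp [hgs₂]
    have hval1 : gateVal gs₂ gs.length = X (x i) * f i := by
      rw [gateVal_prod_two hget1, opVal_var,
        (hl i List.mem_cons_self).opVal_eq hpre le_rfl]
    have hval2 : gateVal gs₂ (gs.length + 1) = A + X (x i) * f i := by
      rw [gateVal_sum_two hget2, hacc.opVal_eq hpre (Nat.le_succ _), opVal_gate,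
        if_pos (Nat.lt_succ_self _), hval1]
    have hacc' : OpOK gs₂ (.gate (gs.length + 1)) (A + X (x i) * f i) := ⟨by omega, hval2⟩
    have hl' : ∀ i' ∈ rest, OpOK gs₂ (u i') (f i') :=
      fun i' hi' => (hl i' (List.mem_cons_of_mem _ hi')).of_prefix hpre
    obtain ⟨hpre', hok, hcount, hmem⟩ := emitAcc_spec f rest gs₂ _ _ hacc' hl'
    have hunfold : emitAcc x u gs acc (i :: rest) = emitAcc x u gs₂ (.gate (gs.length + 1)) rest :=
      rfl
    rw [hunfold]
    refine ⟨hpre.trans hpre', ?_, ?_, ?_⟩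
    · simpa [add_assoc] using hok
    · rw [hcount, hgs₂, List.countP_append]
      simp [isProdGate]
      omega
    · intro g hg
      rcases hmem g hg with hg | hg
      · rw [hgs₂, List.mem_append] at hg
        rcases hg with hg | hg
        · exact Or.inl hg
        · simp only [List.mem_cons, List.not_mem_nil, or_false] at hg
          rcases hg with rfl | rfl
          · exact Or.inr ⟨rfl, trivial⟩
          · exact Or.inr ⟨rfl, fun a ha => by simp at ha; rcases ha with rfl | rfl <;> rfl⟩
      · exact Or.inr hg

/-- Specification of `emitSumProd` for a nonempty list: valid operand with value
`Σ_{i ∈ l} X_{x i} · f i`, `|l|` new product gates, all new gates binary products or plain binary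
sums. [cite: JerrumSnir1982, §4.3 (p. 889)] -/
theorem emitSumProd_spec (f : ι → MvPolynomial σ k) {l : List ι} (hl0 : l ≠ [])
    (gs : List (Gate k σ)) (hl : ∀ i ∈ l, OpOK gs (u i) (f i)) :
    gs <+: (emitSumProd x u gs l).1 ∧
    OpOK (emitSumProd x u gs l).1 (emitSumProd x u gs l).2 (l.map fun i => X (x i) * f i).sum ∧
    ((emitSumProd x u gs l).1.countP fun g => isProdGate g) =
      (gs.countP fun g => isProdGate g) + l.length ∧
    (∀ g ∈ (emitSumProd x u gs l).1, g ∈ gs ∨ (g.fanIn = 2 ∧ IsPlainGate g)) := by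
  cases l with
  | nil => exact absurd rfl hl0
  | cons i rest =>
    set gs₁ := gs ++ [Gate.prod [.var (x i), u i]] with hgs₁
    have hpre : gs <+: gs₁ := List.prefix_append _ _
    have hget1 : gs₁[gs.length]? = some (Gate.prod [.var (x i), u i]) := by simp [hgs₁]
    have hval1 : gateVal gs₁ gs.length = X (x i) * f i := by
      rw [gateVal_prod_two hget1, opVal_var,
        (hl i List.mem_cons_self).opVal_eq hpre le_rfl]
    have hacc : OpOK gs₁ (.gate gs.length) (X (x i) * f i) := ⟨by simp [hgs₁], hval1⟩
    have hl' : ∀ i' ∈ rest, OpOK gs₁ (u i') (f i') :=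
      fun i' hi' => (hl i' (List.mem_cons_of_mem _ hi')).of_prefix hpre
    obtain ⟨hpre', hok, hcount, hmem⟩ := emitAcc_spec x u f rest gs₁ _ _ hacc hl'
    have hunfold : emitSumProd x u gs (i :: rest) = emitAcc x u gs₁ (.gate gs.length) rest := rfl
    rw [hunfold]
    refine ⟨hpre.trans hpre', ?_, ?_, ?_⟩
    · simpa using hok
    · rw [hcount, hgs₁, List.countP_append]
      simp [isProdGate]
      omega
    · intro g hg
      rcases hmem g hg with hg | hg
      · rw [hgs₁, List.mem_append] at hg
        rcases hg with hg | hg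
        · exact Or.inl hg
        · simp only [List.mem_cons, List.not_mem_nil, or_false] at hg
          subst hg
          exact Or.inr ⟨rfl, trivial⟩
      · exact Or.inr hg

end Emit

/-! ### Subpermanents of the first rows (JS p. 889) -/

section SubPer

variable {n : ℕ}

/-- The subpermanent of the generic matrix `(X_{ij})` on the column set `T` and the first `|T|`
rows ("the permanents of all the `r × r` submatrices contained in the first `r` rows of `X`").
[cite: JerrumSnir1982, §4.3 (p. 889)] -/
def subPer (T : Finset (Fin n)) : MvPolynomial (Fin n × Fin n) ℝ≥0 :=
  (Matrix.mvPolynomialX (Fin n) (Fin n) ℝ≥0).subperm (· ∈ T) (fun j : Fin n => (j : ℕ) < T.card)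

/-- A `1 × 1` subpermanent of the first row is a variable: `subPer {i} = X_{0,i}`.
[cite: JerrumSnir1982, §4.3 (p. 889, `C(1) = 0`)] -/
theorem subPer_singleton (hn : 0 < n) (i : Fin n) : subPer {i} = X (⟨0, hn⟩, i) := by
  unfold subPer
  rw [(Matrix.mvPolynomialX (Fin n) (Fin n) ℝ≥0).subperm_expand_row ⟨0, hn⟩
    (by simp), Finset.filter_univ_mem, Finset.sum_singleton, Matrix.subperm_of_isEmpty,
    mul_one, Matrix.mvPolynomialX_apply]
  · intro i'
    simp
  · intro j ⟨hj, hj'⟩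
    apply hj'
    ext
    simp only [Finset.card_singleton] at hj
    show (j : ℕ) = 0
    omega

/-- **Laplace expansion along the last row**: for `|S| = r + 1`,
`subPer S = Σ_{i ∈ S} X_{r,i} · subPer (S \\ {i})`. [cite: JerrumSnir1982, §4.3 (p. 889)] -/
theorem subPer_step (r : Fin n) (S : Finset (Fin n)) (hS : S.card = (r : ℕ) + 1) :
    subPer S = ∑ i ∈ S, X (r, i) * subPer (S.erase i) := by
  unfold subPer
  rw [(Matrix.mvPolynomialX (Fin n) (Fin n) ℝ≥0).subperm_expand_row r (by rw [hS]; omega),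
    Finset.filter_univ_mem]
  refine Finset.sum_congr rfl fun i hi => ?_
  rw [Matrix.mvPolynomialX_apply, Finset.card_erase_of_mem hi, hS, Nat.add_sub_cancel]
  congr 1
  apply Matrix.subperm_congr
  · intro i'
    rw [Finset.mem_erase]
    tauto
  · intro j
    rw [Ne, Fin.ext_iff]
    show (j : ℕ) < (r : ℕ) + 1 ∧ ¬ ((j : ℕ) = (r : ℕ)) ↔ (j : ℕ) < (r : ℕ)
    omega

/-- The top subpermanent is the permanent: `subPer univ = per (X_{ij})`.
[cite: JerrumSnir1982, §4.3 (p. 889)] -/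
theorem subPer_univ : subPer (Finset.univ : Finset (Fin n)) = perPoly (Fin n) ℝ≥0 := by
  unfold subPer perPoly
  rw [← Matrix.subperm_true]
  apply Matrix.subperm_congr
  · intro i; simp
  · intro j; simp [j.isLt]

end SubPer

/-! ### The circuit of the permanental Laplace expansion -/

section Build

variable {n : ℕ}

/-- A state of the construction: the gates emitted so far and, for every column set, an operand
(meaningful for the column sets already processed). [cite: JerrumSnir1982, §4.3 (p. 889)] -/
structure BState (n : ℕ) where
  /-- the gates emitted so far -/
  gs : List (Gate ℝ≥0 (Fin n × Fin n))
  /-- the operand holding the subpermanent of each processed column set -/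
  env : Finset (Fin n) → Operand ℝ≥0 (Fin n × Fin n)

/-- Process one column set `S` of size `r + 1`: emit `subPer S = Σ_{i ∈ S} X_{r,i} · subPer (S \\ {i})`
from the operands of the sets `S \\ {i}` and record the resulting operand.
[cite: JerrumSnir1982, §4.3 (p. 889)] -/
def processSubset (r : Fin n) (st : BState n) (S : Finset (Fin n)) : BState n :=
  ⟨(emitSumProd (fun i => (r, i)) (fun i => st.env (S.erase i)) st.gs S.toList).1,
    Function.update st.env S
      (emitSumProd (fun i => (r, i)) (fun i => st.env (S.erase i)) st.gs S.toList).2⟩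

/-- Process all column sets of size `r + 1` (the subpermanents of the first `r + 1` rows).
[cite: JerrumSnir1982, §4.3 (p. 889)] -/
def processLevel (r : Fin n) (st : BState n) : BState n :=
  ((Finset.univ : Finset (Fin n)).powersetCard ((r : ℕ) + 1)).toList.foldl (processSubset r) st

/-- Process the levels `m + 1, m + 2, …, n` in turn. [cite: JerrumSnir1982, §4.3 (p. 889)] -/
def buildFrom : ℕ → BState n → BState n
  | m, st => if h : m < n then buildFrom (m + 1) (processLevel ⟨m, h⟩ st) else st
  termination_by m => n - m

/-- The initial operands: the `1 × 1` subpermanents of the first row are the variables `X_{0,i}`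
(no gates, `C(1) = 0`). [cite: JerrumSnir1982, §4.3 (p. 889)] -/
def initEnv (hn : 0 < n) (T : Finset (Fin n)) : Operand ℝ≥0 (Fin n × Fin n) :=
  if h : T.card = 1 then .var (⟨0, hn⟩, (Finset.card_eq_one.1 h).choose) else .const 0

/-- **The permanental Laplace expansion as a monotone computation** of `per (X_{ij})`, `n ≥ 1`.
[cite: JerrumSnir1982, §4.3 (p. 889)] -/
def laplaceCircuit (hn : 0 < n) : ArithCircuit ℝ≥0 (Fin n × Fin n) where
  gates := (buildFrom 1 ⟨[], initEnv hn⟩).gs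
  output := (buildFrom 1 ⟨[], initEnv hn⟩).env Finset.univ

/-- The invariant: the operands of the column sets in `D` are valid and hold their
subpermanents. [cite: JerrumSnir1982, §4.3 (p. 889)] -/
def Good (st : BState n) (D : Set (Finset (Fin n))) : Prop :=
  ∀ T ∈ D, OpOK st.gs (st.env T) (subPer T)

/-- All gates are binary products or plain binary sums. [folklore] -/
def GatesOK (gs : List (Gate ℝ≥0 (Fin n × Fin n))) : Prop :=
  ∀ g ∈ gs, g.fanIn = 2 ∧ IsPlainGate g

/-- Processing one column set. [cite: JerrumSnir1982, §4.3 (p. 889)] -/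
theorem processSubset_spec {r : Fin n} {st : BState n} {D : Set (Finset (Fin n))}
    (hst : Good st D) (hgs : GatesOK st.gs) {S : Finset (Fin n)} (hS : S.card = (r : ℕ) + 1)
    (hD : ∀ i ∈ S, S.erase i ∈ D) :
    Good (processSubset r st S) (insert S D) ∧ GatesOK (processSubset r st S).gs ∧
      st.gs <+: (processSubset r st S).gs ∧
      ((processSubset r st S).gs.countP fun g => isProdGate g) =
        (st.gs.countP fun g => isProdGate g) + ((r : ℕ) + 1) := by
  have hl0 : S.toList ≠ [] := Finset.Nonempty.toList_ne_nil (Finset.card_pos.1 (by omega))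
  have hl : ∀ i ∈ S.toList, OpOK st.gs (st.env (S.erase i)) (subPer (S.erase i)) :=
    fun i hi => hst _ (hD i (Finset.mem_toList.1 hi))
  obtain ⟨hpre, hok, hcount, hmem⟩ :=
    emitSumProd_spec (fun i => (r, i)) (fun i => st.env (S.erase i)) (fun i => subPer (S.erase i))
      hl0 st.gs hl
  rw [Finset.sum_map_toList, ← subPer_step r S hS] at hok
  refine ⟨?_, ?_, hpre, ?_⟩
  · intro T hT
    show OpOK _ (Function.update st.env S _ T) _
    by_cases hTS : T = S
    · subst hTS
      rw [Function.update_self]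
      exact hok
    · rw [Function.update_of_ne hTS]
      rcases hT with rfl | hT
      · exact absurd rfl hTS
      · exact (hst T hT).of_prefix hpre
  · intro g hg
    rcases hmem g hg with hg | hg
    · exact hgs g hg
    · exact hg
  · change List.countP (fun g => isProdGate g)
        (emitSumProd (fun i => (r, i)) (fun i => st.env (S.erase i)) st.gs S.toList).1 = _
    rw [hcount, Finset.length_toList, hS]

/-- The column sets of size between `1` and `m`. [folklore] -/
def levelsLe (n m : ℕ) : Set (Finset (Fin n)) := {T | 1 ≤ T.card ∧ T.card ≤ m}

/-- Processing a list of column sets of size `r + 1` over a state good for the sizes `≤ r`.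
[cite: JerrumSnir1982, §4.3 (p. 889)] -/
theorem foldl_processSubset_spec (r : Fin n) (hr : 1 ≤ (r : ℕ)) :
    ∀ (l : List (Finset (Fin n))) (st : BState n) (D : Set (Finset (Fin n))),
      levelsLe n r ⊆ D → Good st D → GatesOK st.gs → (∀ S ∈ l, S.card = (r : ℕ) + 1) →
        Good (l.foldl (processSubset r) st) (D ∪ {S | S ∈ l}) ∧
        GatesOK (l.foldl (processSubset r) st).gs ∧
        st.gs <+: (l.foldl (processSubset r) st).gs ∧
        ((l.foldl (processSubset r) st).gs.countP fun g => isProdGate g) =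
          (st.gs.countP fun g => isProdGate g) + l.length * ((r : ℕ) + 1)
  | [], st, D, _, hst, hgs, _ => by
    refine ⟨fun T hT => ?_, hgs, List.prefix_rfl, by simp⟩
    rcases hT with hT | hT
    · exact hst T hT
    · simp at hT
  | S :: rest, st, D, hD, hst, hgs, hl => by
    have hS : S.card = (r : ℕ) + 1 := hl S List.mem_cons_self
    have hDS : ∀ i ∈ S, S.erase i ∈ D := by
      intro i hi
      apply hD
      refine ⟨?_, ?_⟩ <;> rw [Finset.card_erase_of_mem hi, hS] <;> omega
    obtain ⟨h1, h2, h3, h4⟩ := processSubset_spec hst hgs hS hDS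
    obtain ⟨h1', h2', h3', h4'⟩ := foldl_processSubset_spec r hr rest (processSubset r st S)
      (insert S D) (hD.trans (Set.subset_insert _ _)) h1 h2
      (fun S' hS' => hl S' (List.mem_cons_of_mem _ hS'))
    rw [List.foldl_cons]
    refine ⟨fun T hT => h1' T ?_, h2', h3.trans h3', ?_⟩
    · rcases hT with hT | hT
      · exact Or.inl (Set.mem_insert_of_mem _ hT)
      · simp only [Set.mem_setOf_eq, List.mem_cons] at hT
        rcases hT with rfl | hT
        · exact Or.inl (Set.mem_insert _ _)
        · exact Or.inr hT
    · rw [h4', h4, List.length_cons]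
      ring

/-- Processing one level. [cite: JerrumSnir1982, §4.3 (p. 889, `C(r) = C(r-1) + r·(n choose r)`)] -/
theorem processLevel_spec (r : Fin n) (hr : 1 ≤ (r : ℕ)) (st : BState n)
    (hst : Good st (levelsLe n r)) (hgs : GatesOK st.gs) :
    Good (processLevel r st) (levelsLe n ((r : ℕ) + 1)) ∧ GatesOK (processLevel r st).gs ∧
      st.gs <+: (processLevel r st).gs ∧
      ((processLevel r st).gs.countP fun g => isProdGate g) =
        (st.gs.countP fun g => isProdGate g) + n.choose ((r : ℕ) + 1) * ((r : ℕ) + 1) := by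
  obtain ⟨h1, h2, h3, h4⟩ := foldl_processSubset_spec r hr
    ((Finset.univ : Finset (Fin n)).powersetCard ((r : ℕ) + 1)).toList st (levelsLe n r)
    le_rfl hst hgs (fun S hS => (Finset.mem_powersetCard.1 (Finset.mem_toList.1 hS)).2)
  refine ⟨fun T ⟨hT1, hT2⟩ => h1 T ?_, h2, h3, ?_⟩
  · rcases Nat.lt_or_ge (T.card) ((r : ℕ) + 1) with hlt | hge
    · exact Or.inl ⟨hT1, by omega⟩
    · refine Or.inr ?_
      simp only [Set.mem_setOf_eq, Finset.mem_toList, Finset.mem_powersetCard]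
      exact ⟨Finset.subset_univ _, by omega⟩
  · change List.countP (fun g => isProdGate g) (List.foldl (processSubset r) st
        ((Finset.univ : Finset (Fin n)).powersetCard ((r : ℕ) + 1)).toList).gs = _
    rw [h4, Finset.length_toList, Finset.card_powersetCard, Finset.card_univ, Fintype.card_fin]

/-- Processing all remaining levels. [cite: JerrumSnir1982, §4.3 (p. 889)] -/
theorem buildFrom_spec (m : ℕ) (hm : 1 ≤ m) (st : BState n) (hst : Good st (levelsLe n m))
    (hgs : GatesOK st.gs) :
    Good (buildFrom m st) (levelsLe n n) ∧ GatesOK (buildFrom m st).gs ∧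
      ((buildFrom m st).gs.countP fun g => isProdGate g) =
        (st.gs.countP fun g => isProdGate g) +
          ∑ j ∈ Finset.Ico m n, n.choose (j + 1) * (j + 1) := by
  rw [buildFrom]
  split_ifs with h
  · obtain ⟨h1, h2, -, h4⟩ := processLevel_spec ⟨m, h⟩ hm st hst hgs
    obtain ⟨h1', h2', h4'⟩ := buildFrom_spec (m + 1) (by omega) _ h1 h2
    refine ⟨h1', h2', ?_⟩
    rw [h4', h4, Finset.sum_eq_sum_Ico_succ_bot h]
    ring
  · refine ⟨fun T ⟨hT1, hT2⟩ => hst T ⟨hT1, ?_⟩, hgs, ?_⟩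
    · have : T.card ≤ n := by simpa using Finset.card_le_univ T
      omega
    · rw [Finset.Ico_eq_empty (by omega), Finset.sum_empty, add_zero]
termination_by n - m

/-- The initial state is good for the singletons: `subPer {i} = X_{0,i}` is the variable operand.
[cite: JerrumSnir1982, §4.3 (p. 889, `C(1) = 0`)] -/
theorem good_init (hn : 0 < n) : Good (⟨[], initEnv hn⟩ : BState n) (levelsLe n 1) := by
  rintro T ⟨h1, h2⟩
  have hT : T.card = 1 := le_antisymm h2 h1
  obtain ⟨i, rfl⟩ := Finset.card_eq_one.1 hT
  show OpOK [] (initEnv hn {i}) (subPer {i})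
  unfold initEnv
  rw [dif_pos hT]
  have hc : (Finset.card_eq_one.1 hT).choose = i :=
    (Finset.singleton_injective (Finset.card_eq_one.1 hT).choose_spec).symm
  rw [hc]
  exact (subPer_singleton hn i).symm

/-- `Σ_{j=1}^{n-1} (j+1)·C(n, j+1) = Σ_{r=2}^{n} r·C(n,r) = n (2^{n-1} - 1)` (JS's recurrence
`C(r) = C(r-1) + r·(n choose r)`, `C(1) = 0`, summed). [cite: JerrumSnir1982, §4.3 (p. 889)] -/
theorem sum_Ico_choose_mul (hn : 1 ≤ n) :
    ∑ j ∈ Finset.Ico 1 n, n.choose (j + 1) * (j + 1) = n * (2 ^ (n - 1) - 1) := by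
  have hterm : ∀ j ∈ Finset.Ico 1 n, n.choose (j + 1) * (j + 1) = n * (n - 1).choose j := by
    intro j _
    have h := Nat.add_one_mul_choose_eq (n - 1) j
    simp only [Nat.sub_add_cancel hn] at h
    exact h.symm
  rw [Finset.sum_congr rfl hterm, ← Finset.mul_sum]
  congr 1
  have h2 := Nat.sum_range_choose (n - 1)
  rw [Nat.sub_add_cancel hn, Finset.range_eq_Ico,
    Finset.sum_eq_sum_Ico_succ_bot (by omega : 0 < n), Nat.choose_zero_right, zero_add] at h2
  generalize 2 ^ (n - 1) = p at h2 ⊢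
  omega

/-- **Jerrum–Snir 1982, §4.3 — the upper bound: the permanental Laplace expansion is a monotone
computation of `per_n` with exactly `n (2^{n-1} - 1)` product gates** ("This lower bound is in
fact attained by the permanental equivalent of Laplace's expansion rule ... The upper bound of
`n(2^{n-1} - 1)` is then implied by the recurrence `C(r) = C(r-1) + r·(n choose r)`, `C(1) = 0`").
[cite: JerrumSnir1982, §4.3 (p. 889)] -/
theorem laplaceCircuit_spec (hn : 0 < n) :
    IsMonotoneComputation (laplaceCircuit hn) (perPoly (Fin n) ℝ≥0) ∧
      prodCount (laplaceCircuit hn) = n * (2 ^ (n - 1) - 1) := by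
  obtain ⟨hgood, hgates, hcount⟩ :=
    buildFrom_spec 1 le_rfl (⟨[], initEnv hn⟩ : BState n) (good_init hn) (fun g hg => by simp at hg)
  have huniv : OpOK (buildFrom 1 (⟨[], initEnv hn⟩ : BState n)).gs
      ((buildFrom 1 (⟨[], initEnv hn⟩ : BState n)).env Finset.univ) (subPer Finset.univ) :=
    hgood _ ⟨by rw [Finset.card_univ, Fintype.card_fin]; exact hn,
      by rw [Finset.card_univ, Fintype.card_fin]⟩
  refine ⟨⟨fun g hg => (hgates g hg).1.le, fun g hg => (hgates g hg).2, ?_⟩, ?_⟩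
  · show (laplaceCircuit hn).eval = perPoly (Fin n) ℝ≥0
    rw [eval_eq_opVal, ← subPer_univ]
    exact huniv.opVal_eq List.prefix_rfl le_rfl
  · show List.countP _ (buildFrom 1 (⟨[], initEnv hn⟩ : BState n)).gs = _
    rw [hcount, sum_Ico_choose_mul hn]
    simp

/-- Hence a monotone computation of `per_n`, `n ≥ 1`, with exactly `n (2^{n-1} - 1)` product gates
exists. [cite: JerrumSnir1982, §4.3 (p. 889)] -/
theorem exists_isMonotoneComputation_perPoly (hn : 1 ≤ n) :
    ∃ P : ArithCircuit ℝ≥0 (Fin n × Fin n), IsMonotoneComputation P (perPoly (Fin n) ℝ≥0) ∧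
      prodCount P = n * (2 ^ (n - 1) - 1) :=
  ⟨laplaceCircuit hn, laplaceCircuit_spec hn⟩

end Build

end JerrumSnir

end Literature.Barriers.ValiantsHypothesis
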